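import Summits.ValiantsHypothesis.ValiantsHypothesis.Theses.SliceSignRank
import Summits.ValiantsHypothesis.ValiantsHypothesis.Theorems.SliceSignRankSignRankSuperQPVdwHadamard
import Summits.ValiantsHypothesis.ValiantsHypothesis.Theorems.SliceSignRankPositiveSliceNormalFormSplit

/-!
# Crux `SrkNotQP` (stmt-ValiantsHypothesis-20857, route SliceSignRank, binder #301 of `closes`) —
skeleton of line `forster-slice`

The SRK∞ binder `SrkNotQP` (i.o. quasi-polynomial sign-rank hardness of `sgn` on `S_n`) follows from the
a.e. form `SignRankSuperQP` by the LANDED `srkNotQP_of_signRankSuperQP`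
(Theorems/SliceSignRankPositiveSliceNormalFormSplit.lean), and `SignRankSuperQP` has the registered
birth skeleton `Cruxes/SignRankSuperQP/Lines/birth.lean` (planner, 2026-08-17): composition
`SignRankSuperQP_of : stub_forsterSlice → stub_vdwHadamard → SignRankSuperQP` PROVED, with stub B
`stub_vdwHadamard` LANDED (p558422, `Theorems.SliceSignRank.SignRankSuperQP.stub_vdwHadamard`).
This file is that skeleton RE-HOMED on the binder 20857 (director-valiant g8 2026-08-27 (iv)): the ONLY
sorry is `stub_forsterSlice` (verbatim the birth signature, so ONE landing closes both registrations);
stub B is cited by name; the glue lemmas (`factorial_sq_le_of_signRep`, `eventually_qp_lt_factorial_sq`,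
…) are the birth file's, copied verbatim; `SrkNotQP_of_line : SrkNotQP` concludes the binder BY NAME.
CALIBRATION (honest): `stub_forsterSlice` is conjecture-grade (Forster's inequality for the permutation
slice up to polynomial loss; every known engine — Marcus–Minc, Forster-type — caps sign-rank lower
bounds for this slice at k = O(n), far below quasi-polynomial), so SrkNotQP is OPEN and is ≥ the known
open bound for sign-representations of sgn; it is one of the two load-bearing binders of SliceSignRank's
`closes` (the other, PositiveSliceSignTransfer 20858, has no skeleton).  VP ≠ VNP is not moved here.
Prepared by planner val-width-lines-1 g0 (2026-08-27); registered on 20857 by planner val-width-lines-3 g0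
(2026-08-27, director-valiant g9 REQUESTS l.20032 (a)); mathematics = the birth skeleton's.
-/

set_option linter.dupNamespace false

namespace Summit.ValiantsHypothesis.ValiantsHypothesis.Cruxes.SrkNotQP.ForsterSlice

open Summit.ValiantsHypothesis.ValiantsHypothesis.Theses.SliceSignRank

/-! ## §0 The two stub statements -/

/-- **A — FORSTER'S INEQUALITY FOR THE PERMUTATION SLICE** (stub statement, named; the bet).
There is an exponent `C` such that whenever `k` real twists sign-represent `sgn` on `S_n`
(`0 < sgn σ · Σ_t Π_i W_t(σ i, i)` for all `σ`), some single real twist `V` has `det V ≠ 0` and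
`n! · per(V ∘ V) ≤ k^C · det(V)²` — the `L²`-normalised correlation of `sgn` with the monomial
function `σ ↦ Π_i V(σ i, i)` is at least `k^{-C/2}` (`C = 2`: Forster's exponent).  Degenerate
cases: `k = 0` never represents (empty sum); `n = 0`: `V = ()`, `1 · 1 ≤ k^C · 1`; `n = 1`:
`V = (v)`, `v² ≤ k^C v²`; `n = 2, k = 1`: equality at `V = [[1,−1],[1,1]]`.
[conjecture-grade analogue of Forster2002 (JCSS 65, Thm 2.2); RazborovSherstov2010 §1] -/
def Stmt.stub_forsterSlice : Prop :=
  ∃ C : ℕ, ∀ (n k : ℕ) (W : Fin k → Matrix (Fin n) (Fin n) ℝ),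
    (∀ σ : Equiv.Perm (Fin n), 0 < ((Equiv.Perm.sign σ : ℤ) : ℝ) * ∑ t, ∏ i, W t (σ i) i) →
    ∃ V : Matrix (Fin n) (Fin n) ℝ, V.det ≠ 0 ∧
      (n.factorial : ℝ) * (Matrix.of fun i j => V i j ^ 2).permanent ≤ (k : ℝ) ^ C * V.det ^ 2

/-- **B — VAN DER WAERDEN–HADAMARD BOUND FOR TWISTED CORRELATIONS** (stub statement, named;
provable now): for every real square matrix `V`, `n! · det(V)² ≤ nⁿ · per(V ∘ V)` where `V ∘ V` is the
entrywise square.  (= Gurvits' capacity bound for `Π_i Σ_j V_ij² z_j`, capacity `≥ det(V)²` by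
Hadamard; sharp at Hadamard matrices; `n = 0`: `1 ≤ 1`; `n = 2`: `(ad−bc)² ≤ 2(a²d²+b²c²)`.)
[Egorychev1981 Thm 1 / Falikman1981 / Gurvits2008 §2 + Hadamard's inequality; in tree:
`Gurvits.factorial_mul_le_pow_mul_coeff_one`, `coeff_prod_rowForms_eq_permanent`,
`det_sq_le_prod_sum_sq`] -/
def Stmt.stub_vdwHadamard : Prop :=
  ∀ (n : ℕ) (V : Matrix (Fin n) (Fin n) ℝ),
    (n.factorial : ℝ) * V.det ^ 2 ≤ (n : ℝ) ^ n * (Matrix.of fun i j => V i j ^ 2).permanent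

/-! ## §1 The registered stub (the ONLY sorry of this file) and the landed stub B -/

/-- REGISTERED STUB (the only sorry) = `Stmt.stub_forsterSlice` verbatim = the birth skeleton's
`stub_forsterSlice` verbatim (Forster's inequality for the slice, up to polynomial loss).
[conjecture-grade: Forster2002, RazborovSherstov2010] -/
theorem stub_forsterSlice :
    ∃ C : ℕ, ∀ (n k : ℕ) (W : Fin k → Matrix (Fin n) (Fin n) ℝ),
      (∀ σ : Equiv.Perm (Fin n), 0 < ((Equiv.Perm.sign σ : ℤ) : ℝ) * ∑ t, ∏ i, W t (σ i) i) →
      ∃ V : Matrix (Fin n) (Fin n) ℝ, V.det ≠ 0 ∧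
        (n.factorial : ℝ) * (Matrix.of fun i j => V i j ^ 2).permanent ≤
          (k : ℝ) ^ C * V.det ^ 2 := by
  sorry

/-- Stub B of the birth skeleton, LANDED (p558422): cited by name, no sorry. -/
theorem vdwHadamard : Stmt.stub_vdwHadamard :=
  Summit.ValiantsHypothesis.ValiantsHypothesis.Theorems.SliceSignRank.SignRankSuperQP.stub_vdwHadamard

/-! ## §2 Glue lemmas (sorry-free; verbatim from the birth skeleton) -/

/-- **A + B ⇒ the counting inequality**: if `k` real twists sign-represent `sgn` on `S_n`, then
`(n!)² ≤ nⁿ · k^C` (`C` the exponent of stub A).  Multiply A (`n!·per ≤ k^C det²`) and B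
(`n!·det² ≤ nⁿ per`) and cancel `det² > 0`.  Tight at `n = 2, k = 1`. [this skeleton] -/
theorem factorial_sq_le_of_signRep (C n k : ℕ) (W : Fin k → Matrix (Fin n) (Fin n) ℝ)
    (hW : ∀ σ : Equiv.Perm (Fin n), 0 < ((Equiv.Perm.sign σ : ℤ) : ℝ) * ∑ t, ∏ i, W t (σ i) i)
    (hA : ∀ (n k : ℕ) (W : Fin k → Matrix (Fin n) (Fin n) ℝ),
      (∀ σ : Equiv.Perm (Fin n), 0 < ((Equiv.Perm.sign σ : ℤ) : ℝ) * ∑ t, ∏ i, W t (σ i) i) →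
      ∃ V : Matrix (Fin n) (Fin n) ℝ, V.det ≠ 0 ∧
        (n.factorial : ℝ) * (Matrix.of fun i j => V i j ^ 2).permanent ≤ (k : ℝ) ^ C * V.det ^ 2)
    (hB : Stmt.stub_vdwHadamard) :
    (n.factorial : ℝ) ^ 2 ≤ (n : ℝ) ^ n * (k : ℝ) ^ C := by
  obtain ⟨V, hdet, h1⟩ := hA n k W hW
  have h2 := hB n V
  set P : ℝ := (Matrix.of fun i j => V i j ^ 2).permanent with hP
  have hd : 0 < V.det ^ 2 := by positivity
  have hf : (0 : ℝ) ≤ n.factorial := Nat.cast_nonneg _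
  have hn : (0 : ℝ) ≤ (n : ℝ) ^ n := by positivity
  -- n! · (n! det²) ≤ n! · (nⁿ P) = nⁿ · (n! P) ≤ nⁿ · (k^C det²)
  have h3 : (n.factorial : ℝ) * ((n.factorial : ℝ) * V.det ^ 2) ≤
      (n.factorial : ℝ) * ((n : ℝ) ^ n * P) := mul_le_mul_of_nonneg_left h2 hf
  have h4 : (n : ℝ) ^ n * ((n.factorial : ℝ) * P) ≤ (n : ℝ) ^ n * ((k : ℝ) ^ C * V.det ^ 2) :=
    mul_le_mul_of_nonneg_left h1 hn
  have h5 : (n.factorial : ℝ) ^ 2 * V.det ^ 2 ≤ (n : ℝ) ^ n * (k : ℝ) ^ C * V.det ^ 2 :=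
    calc (n.factorial : ℝ) ^ 2 * V.det ^ 2
        = (n.factorial : ℝ) * ((n.factorial : ℝ) * V.det ^ 2) := by ring
      _ ≤ (n.factorial : ℝ) * ((n : ℝ) ^ n * P) := h3
      _ = (n : ℝ) ^ n * ((n.factorial : ℝ) * P) := by ring
      _ ≤ (n : ℝ) ^ n * ((k : ℝ) ^ C * V.det ^ 2) := h4
      _ = (n : ℝ) ^ n * (k : ℝ) ^ C * V.det ^ 2 := by ring
  exact le_of_mul_le_mul_right h5 hd

/-- Polynomial versus exponential: `(L + c)^c · C ≤ 2^L` for all large `L`. [folklore] -/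
theorem poly_le_two_pow_eventually (c C : ℕ) :
    ∃ L₀ : ℕ, ∀ L : ℕ, L₀ ≤ L → (L + c) ^ c * C ≤ 2 ^ L := by
  have ht := tendsto_pow_const_div_const_pow_of_one_lt c (one_lt_two : (1 : ℝ) < 2)
  set ε : ℝ := ((2 : ℝ) ^ c * ((C : ℝ) + 1))⁻¹ with hε_def
  have hD : (0 : ℝ) < (2 : ℝ) ^ c * ((C : ℝ) + 1) := by positivity
  have hε : (0 : ℝ) < ε := inv_pos.mpr hD
  obtain ⟨L₁, hL₁⟩ := Filter.eventually_atTop.mp (ht.eventually_lt_const hε)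
  refine ⟨max L₁ c, fun L hL => ?_⟩
  have hL1 : L₁ ≤ L := le_of_max_le_left hL
  have hLc : c ≤ L := le_of_max_le_right hL
  have h2L : (0 : ℝ) < (2 : ℝ) ^ L := by positivity
  have h : (L : ℝ) ^ c / 2 ^ L < ε := hL₁ L hL1
  rw [div_lt_iff₀ h2L] at h
  -- (L:ℝ)^c · (2^c (C+1)) < ε · 2^L · (2^c (C+1)) = 2^L
  have h' : (L : ℝ) ^ c * ((2 : ℝ) ^ c * ((C : ℝ) + 1)) < (2 : ℝ) ^ L := by
    have := mul_lt_mul_of_pos_right h hD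
    calc (L : ℝ) ^ c * ((2 : ℝ) ^ c * ((C : ℝ) + 1))
        < ε * 2 ^ L * ((2 : ℝ) ^ c * ((C : ℝ) + 1)) := this
      _ = (ε * ((2 : ℝ) ^ c * ((C : ℝ) + 1))) * 2 ^ L := by ring
      _ = 2 ^ L := by rw [hε_def, inv_mul_cancel₀ hD.ne', one_mul]
  have hnat : (((L + c) ^ c * C : ℕ) : ℝ) < ((2 ^ L : ℕ) : ℝ) := by
    push_cast
    have hLc' : (c : ℝ) ≤ L := by exact_mod_cast hLc
    calc ((L : ℝ) + c) ^ c * C ≤ ((L : ℝ) + L) ^ c * C := by gcongr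
      _ = (L : ℝ) ^ c * ((2 : ℝ) ^ c * (C : ℝ)) := by ring
      _ ≤ (L : ℝ) ^ c * ((2 : ℝ) ^ c * ((C : ℝ) + 1)) := by gcongr; linarith
      _ < (2 : ℝ) ^ L := h'
  exact (by exact_mod_cast hnat : (L + c) ^ c * C < 2 ^ L).le

/-- The analytic input of the composition: `(nⁿ)² < 8ⁿ · (n!)²` for `n ≥ 1`
(`n! ≥ nⁿ/eⁿ` from the exponential series, and `e² < 8`). [folklore] -/
theorem pow_self_sq_lt (n : ℕ) (hn : n ≠ 0) :
    ((n : ℝ) ^ n) ^ 2 < (n.factorial : ℝ) ^ 2 * 8 ^ n := by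
  have hfac : (0 : ℝ) < n.factorial := by exact_mod_cast Nat.factorial_pos n
  have hE : (n : ℝ) ^ n ≤ Real.exp n * n.factorial := by
    have h := Real.pow_div_factorial_le_exp (x := (n : ℝ)) (Nat.cast_nonneg n) n
    rwa [div_le_iff₀ hfac] at h
  have he8 : Real.exp (n : ℝ) ^ 2 < 8 ^ n := by
    have h1 : Real.exp 1 ^ 2 < 8 := by
      have := Real.exp_one_lt_d9
      have h0 : 0 < Real.exp 1 := Real.exp_pos 1
      nlinarith
    have h2 : Real.exp (n : ℝ) ^ 2 = (Real.exp 1 ^ 2) ^ n := by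
      rw [← Real.exp_one_pow n]; ring
    rw [h2]
    exact pow_lt_pow_left₀ h1 (by positivity) hn
  have h0 : (0 : ℝ) ≤ (n : ℝ) ^ n := by positivity
  calc ((n : ℝ) ^ n) ^ 2 ≤ (Real.exp n * n.factorial) ^ 2 := by gcongr
    _ = (n.factorial : ℝ) ^ 2 * Real.exp (n : ℝ) ^ 2 := by ring
    _ < (n.factorial : ℝ) ^ 2 * 8 ^ n := by gcongr

/-- **The asymptotics of the composition**: for every `c, C` there is `n₀` such that
`nⁿ · k^C < (n!)²` whenever `n ≥ n₀` and `k ≤ 2^{(log₂ n + c)^c}` (quasi-polynomial times `nⁿ` loses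
to `(n!)² ≥ n^{2n}/e^{2n}`).  With `L = log₂ n ≥ 4`: `k^C ≤ 2^{C (L+c)^c} ≤ 2^{2^L·…}`, precisely
`C(L+c)^c ≤ 2^L ≤ n` (`poly_le_two_pow_eventually`), so `2^{C(L+c)^c} · 8ⁿ · nⁿ ≤ 2^{Ln} nⁿ ≤ n^{2n}
< 8ⁿ (n!)²`. [folklore] -/
theorem eventually_qp_lt_factorial_sq (c C : ℕ) :
    ∃ n₀ : ℕ, ∀ n : ℕ, n₀ ≤ n → ∀ k : ℕ, k ≤ 2 ^ ((Nat.log 2 n + c) ^ c) →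
      (n : ℝ) ^ n * (k : ℝ) ^ C < (n.factorial : ℝ) ^ 2 := by
  obtain ⟨L₀, hL₀⟩ := poly_le_two_pow_eventually c C
  refine ⟨2 ^ max L₀ 4, fun n hn k hk => ?_⟩
  have hpos : 0 < 2 ^ max L₀ 4 := pow_pos two_pos _
  have hn0 : n ≠ 0 := by omega
  set L := Nat.log 2 n with hL
  have hLge : max L₀ 4 ≤ L := Nat.le_log_of_pow_le one_lt_two hn
  have hL4 : 4 ≤ L := le_of_max_le_right hLge
  have hLL₀ : L₀ ≤ L := le_of_max_le_left hLge
  have h2L : 2 ^ L ≤ n := Nat.pow_log_le_self 2 hn0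
  have hA : (L + c) ^ c * C ≤ 2 ^ L := hL₀ L hLL₀
  -- k^C ≤ 2^A with A := (L + c)^c · C
  have hkC : k ^ C ≤ 2 ^ ((L + c) ^ c * C) :=
    calc k ^ C ≤ (2 ^ ((L + c) ^ c)) ^ C := Nat.pow_le_pow_left hk C
      _ = 2 ^ ((L + c) ^ c * C) := (pow_mul 2 _ _).symm
  -- exponent bookkeeping: A + 3n ≤ L·n
  have hexp : (L + c) ^ c * C + 3 * n ≤ L * n := by
    have h1 : (L + c) ^ c * C ≤ n := hA.trans h2L
    nlinarith [hL4, h1]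
  -- the ℕ chain: k^C · 8ⁿ · nⁿ ≤ 2^A · 8ⁿ · nⁿ = 2^{A+3n} nⁿ ≤ 2^{Ln} nⁿ ≤ nⁿ · nⁿ
  have hchain : k ^ C * 8 ^ n * n ^ n ≤ n ^ n * n ^ n :=
    calc k ^ C * 8 ^ n * n ^ n ≤ 2 ^ ((L + c) ^ c * C) * 8 ^ n * n ^ n := by gcongr
      _ = 2 ^ ((L + c) ^ c * C + 3 * n) * n ^ n := by
          have h8 : (8 : ℕ) ^ n = 2 ^ (3 * n) := by rw [pow_mul]; norm_num
          rw [h8, pow_add]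
      _ ≤ 2 ^ (L * n) * n ^ n :=
          Nat.mul_le_mul_right _ (Nat.pow_le_pow_right two_pos hexp)
      _ = (2 ^ L) ^ n * n ^ n := by rw [pow_mul]
      _ ≤ n ^ n * n ^ n := Nat.mul_le_mul_right _ (Nat.pow_le_pow_left h2L n)
  have hcast : (n : ℝ) ^ n * (k : ℝ) ^ C * 8 ^ n ≤ ((n : ℝ) ^ n) ^ 2 := by
    have h1 : ((k ^ C * 8 ^ n * n ^ n : ℕ) : ℝ) ≤ ((n ^ n * n ^ n : ℕ) : ℝ) := by
      exact_mod_cast hchain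
    push_cast at h1
    calc (n : ℝ) ^ n * (k : ℝ) ^ C * 8 ^ n = (k : ℝ) ^ C * 8 ^ n * (n : ℝ) ^ n := by ring
      _ ≤ (n : ℝ) ^ n * (n : ℝ) ^ n := h1
      _ = ((n : ℝ) ^ n) ^ 2 := by ring
  have hR : ((n : ℝ) ^ n) ^ 2 < (n.factorial : ℝ) ^ 2 * 8 ^ n := pow_self_sq_lt n hn0
  have h8 : (0 : ℝ) < 8 ^ n := by positivity
  have hlt : (n : ℝ) ^ n * (k : ℝ) ^ C * 8 ^ n < (n.factorial : ℝ) ^ 2 * 8 ^ n :=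
    lt_of_le_of_lt hcast hR
  exact lt_of_mul_lt_mul_right hlt h8.le

/-! ## §3 The composition (kernel-checked, no `sorry`) -/

/-- **The crux from the two stubs** (composition; conclusion literally the route decl
`SliceSignRank.SignRankSuperQP`).  Given `c`, take the exponent `C` of stub A and
`n₀ = n₀(c, C)` from `eventually_qp_lt_factorial_sq`; for `n ≥ n₀` and `k ≤ 2^{(log₂ n + c)^c}` a
`k`-term sign-representation `W` would give `(n!)² ≤ nⁿ k^C` (`factorial_sq_le_of_signRep`, A + B)
against `nⁿ k^C < (n!)²`. -/
theorem SignRankSuperQP_of :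
    Stmt.stub_forsterSlice → Stmt.stub_vdwHadamard →
      Summit.ValiantsHypothesis.ValiantsHypothesis.Theses.SliceSignRank.SignRankSuperQP := by
  rintro ⟨C, hA⟩ hB c
  obtain ⟨n₀, hn₀⟩ := eventually_qp_lt_factorial_sq c C
  refine ⟨n₀, fun n hn k hk hrep => ?_⟩
  obtain ⟨W, hW⟩ := hrep
  exact absurd (factorial_sq_le_of_signRep C n k W hW hA hB) (not_le.mpr (hn₀ n hn k hk))

/-- THE BINDER `SrkNotQP` BY NAME (hypothesis-free): registered stub A + landed stub B ⇒ `SignRankSuperQP`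
(birth composition) ⇒ `SrkNotQP` (landed `srkNotQP_of_signRankSuperQP`). -/
theorem SrkNotQP_of_line :
    Summit.ValiantsHypothesis.ValiantsHypothesis.Theses.SliceSignRank.SrkNotQP :=
  Summit.ValiantsHypothesis.ValiantsHypothesis.Theorems.SliceSignRankPositiveSliceNormalFormSplit.srkNotQP_of_signRankSuperQP
    (SignRankSuperQP_of stub_forsterSlice vdwHadamard)

end Summit.ValiantsHypothesis.ValiantsHypothesis.Cruxes.SrkNotQP.ForsterSlice
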